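import Mathlib.RingTheory.MvPolynomial.Homogeneous
import Mathlib.Data.ZMod.Basic
import Literature.LinearAlgebra.Matrix.FaddeevLeVerrier
import Mathlib.Algebra.MvPolynomial.Funext
import Literature.Computability.AlgebraicComplexity.PowTraceFromDetRepr
import Literature.Computability.AlgebraicComplexity.DeterminantalComplexityProofs
import Literature.Computability.AlgebraicComplexity.SymbolicMatrixDecomposition
import Literature.Computability.AlgebraicComplexity.SymmetrizedMatMul
import HarnessLib

/-!
# Coefficients of the characteristic polynomial of a matrix of linear forms as traces of matrix
powers (the Faddeev–LeVerrier branching program)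

Topic `Literature/Computability/AlgebraicComplexity`; support for — and, in the appendix at the
end of this file, the discharge of — the named fact `IkenmeyerLandsberg2017_powTrace_of_detRepr`
(`PowTraceFromDetRepr.lean`): the step "affine determinantal expression ⇒ homogeneous
layered algebraic branching program ⇒ trace of a matrix power" of Ikenmeyer–Landsberg 2017,
Thm. 4.1 and Rem. 4.5, carried out over a field of characteristic zero with the
**Faddeev–LeVerrier recursion** (tree: `Literature.LinearAlgebra.Matrix.flMat`,
`flMat_eq_mul_add`, `sub_mul_charpoly_coeff`) in place of the Mahajan–Vinay clow-sequence
program of the printed proof (same shape — a layered program of width `s²` whose layer `ℓ` holds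
the entries of the Faddeev–LeVerrier matrix `N_{s-1-ℓ}` — but its correctness is LeVerrier's
trace identity, already proved in the tree, instead of the clow involution).

For an `s × s` matrix `M` (`s = m + 1`) over `MvPolynomial σ K` and `1 ≤ d = n + 1 ≤ s`:

* `FLPowTrace.blockCyclic_pow_apply`, `FLPowTrace.trace_blockCyclic_pow` — powers and the
  `N`-th power trace of a block matrix on `ZMod N × W` whose only non-zero blocks sit at
  `(ℓ, ℓ+1)` ("identify the source and the sink … all closed directed walks have length exactly
  `m`", Rem. 4.5; the trace counts every closed walk once per starting layer, whence a factor `N`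
  removed later by rescaling — characteristic zero);
* `FLPowTrace.flVec_vecMul_flStep` — one layer of the program: the row vector of entries of
  `N_{m-k}` times the layer matrix is the row vector of entries of `N_{m-k-1}`
  (`N_{l-1} = M N_l + c_l 1`, `(s-l) c_l = -tr(M N_l)`);
* `FLPowTrace.exists_trace_pow_eq_charpoly_coeff` — for every scalar `θ` an explicit matrix `A`
  of size `d s²` with `tr(A^d) = -d² θ · c_{s-d}(M)` whose entries are homogeneous linear forms
  when the entries of `M` are;
* `charpoly_coeff_isHomogeneous` (`c_{s-k}(M)` is homogeneous of degree `k`) and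
  `homogeneousComponent_det_one_sub` (`[det(1 - M)]_d = c_{s-d}(M)`).

Everything is proved; no named facts, no definitions (the layer matrices are passed to the
lemmas as variables with their defining equations).

## References

* C. Ikenmeyer, J. M. Landsberg, *On the complexity of the permanent in various computational
  models*, J. Pure Appl. Algebra 221 (2017) 2911–2927 = arXiv:1610.00159, Thm. 4.1, Rem. 4.5.
  [IkenmeyerLandsberg2017]
* Z. Altaç, *Numerical Methods for Scientists and Engineers*, CRC 2024, §11.8 (Faddeev–LeVerrier;
  the recursion is `Literature/LinearAlgebra/Matrix/FaddeevLeVerrier.lean`). [Altac2024]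
* L. Csanky, *Fast parallel matrix inversion algorithms*, SIAM J. Comput. 5 (1976) 618–623 (the
  determinant from traces of powers in characteristic zero; attribution only).
-/

namespace Literature.Computability.AlgebraicComplexity

open MvPolynomial

namespace FLPowTrace

open Literature.LinearAlgebra.Matrix

/-! ### Block-cyclic matrices: powers and the trace of the `N`-th power -/

section BlockCyclic

variable {R : Type*} [CommRing R] {W : Type*} [Fintype W] [DecidableEq W] {N : ℕ}

/-- `Lay ℓ · Lay (ℓ+1) ⋯ Lay (ℓ+k) = (Lay ℓ ⋯ Lay (ℓ+k-1)) · Lay (ℓ+k)`. [folklore] -/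
theorem layerProd_succ (Lay : ZMod N → Matrix W W R) (ℓ : ZMod N) (k : ℕ) :
    ((List.range (k + 1)).map fun i : ℕ => Lay (ℓ + i)).prod =
      ((List.range k).map fun i : ℕ => Lay (ℓ + i)).prod * Lay (ℓ + k) := by
  rw [List.range_succ, List.map_append, List.map_singleton, List.prod_append,
    List.prod_singleton]

/-- Splitting a product of consecutive layer matrices. [folklore] -/
theorem layerProd_add (Lay : ZMod N → Matrix W W R) (ℓ : ZMod N) (j k : ℕ) :
    ((List.range (j + k)).map fun i : ℕ => Lay (ℓ + i)).prod =
      ((List.range j).map fun i : ℕ => Lay (ℓ + i)).prod *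
        ((List.range k).map fun i : ℕ => Lay (ℓ + j + i)).prod := by
  induction k with
  | zero => rw [add_zero, List.range_zero, List.map_nil, List.prod_nil, Matrix.mul_one]
  | succ k ih =>
    rw [← add_assoc, layerProd_succ, ih, layerProd_succ, Matrix.mul_assoc]
    have harg : ℓ + ((j + k : ℕ) : ZMod N) = ℓ + (j : ZMod N) + (k : ZMod N) := by
      push_cast; ring
    rw [harg]

/-- **Powers of a block-cyclic matrix.** If `A` on `ZMod N × W` has the block `Lay ℓ` at
`(ℓ, ℓ+1)` and zero blocks elsewhere, then `A^k` has the block `Lay ℓ ⋯ Lay (ℓ+k-1)` at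
`(ℓ, ℓ+k)` and zero blocks elsewhere (walks of length `k` advance `k` layers). [folklore] -/
theorem blockCyclic_pow_apply [NeZero N] (Lay : ZMod N → Matrix W W R)
    (A : Matrix (ZMod N × W) (ZMod N × W) R)
    (hA : ∀ p q, A p q = if q.1 = p.1 + 1 then Lay p.1 p.2 q.2 else 0) (k : ℕ)
    (p q : ZMod N × W) :
    (A ^ k) p q =
      if q.1 = p.1 + k then ((List.range k).map fun i : ℕ => Lay (p.1 + i)).prod p.2 q.2
      else 0 := by
  induction k generalizing p q with
  | zero =>
    obtain ⟨p1, p2⟩ := p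
    obtain ⟨q1, q2⟩ := q
    simp only [pow_zero, Nat.cast_zero, add_zero, List.range_zero, List.map_nil, List.prod_nil,
      Matrix.one_apply, Prod.mk.injEq]
    by_cases h1 : p1 = q1
    · subst h1
      simp
    · rw [if_neg (fun h => h1 h.1), if_neg (Ne.symm h1)]
  | succ k ih =>
    rw [pow_succ, Matrix.mul_apply, Fintype.sum_prod_type,
      Fintype.sum_eq_single (p.1 + (k : ZMod N)) (fun r1 hr1 => by
        refine Finset.sum_eq_zero fun r2 _ => ?_
        rw [ih, if_neg (by simpa using hr1), zero_mul])]
    by_cases hq : q.1 = p.1 + (k : ZMod N) + 1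
    · rw [if_pos (by rw [hq]; push_cast; ring), layerProd_succ, Matrix.mul_apply]
      refine Finset.sum_congr rfl fun r2 _ => ?_
      rw [ih, if_pos rfl, hA, if_pos hq]
    · rw [if_neg (by rw [Nat.cast_succ, ← add_assoc]; exact hq)]
      refine Finset.sum_eq_zero fun r2 _ => ?_
      rw [hA, if_neg hq, mul_zero]

/-- **Trace of the `N`-th power of a block-cyclic matrix on `N` layers**: every layer contributes
the trace of the cyclic product of all `N` blocks, and these traces agree (trace of a rotated
product), so `tr(A^N) = N · tr(Lay 0 ⋯ Lay (N-1))`. This is the count behind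
Ikenmeyer–Landsberg's Rem. 4.5 (closed walks of length `N` in the source–sink identified layered
graph), with the multiplicity `N` of each closed walk (one per starting layer) made explicit.
[cite: IkenmeyerLandsberg2017, Rem. 4.5] -/
theorem trace_blockCyclic_pow [NeZero N] (Lay : ZMod N → Matrix W W R)
    (A : Matrix (ZMod N × W) (ZMod N × W) R)
    (hA : ∀ p q, A p q = if q.1 = p.1 + 1 then Lay p.1 p.2 q.2 else 0) :
    (A ^ N).trace = (N : R) * (((List.range N).map fun i : ℕ => Lay (0 + i)).prod).trace := by
  -- every rotation of the cyclic product has the same trace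
  have hrot : ∀ ℓ : ZMod N, (((List.range N).map fun i : ℕ => Lay (ℓ + i)).prod).trace =
      (((List.range N).map fun i : ℕ => Lay (0 + i)).prod).trace := by
    intro ℓ
    have hj : ℓ.val < N := ZMod.val_lt ℓ
    have hℓ : ((ℓ.val : ℕ) : ZMod N) = ℓ := ZMod.natCast_zmod_val ℓ
    have h1 := layerProd_add Lay 0 ℓ.val (N - ℓ.val)
    have h2 := layerProd_add Lay ℓ (N - ℓ.val) ℓ.val
    rw [Nat.add_sub_cancel' hj.le, zero_add, hℓ] at h1
    rw [Nat.sub_add_cancel hj.le] at h2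
    have h3 : ℓ + ((N - ℓ.val : ℕ) : ZMod N) = 0 := by
      have : ((ℓ.val + (N - ℓ.val) : ℕ) : ZMod N) = 0 := by
        rw [Nat.add_sub_cancel' hj.le, ZMod.natCast_self]
      rwa [Nat.cast_add, hℓ] at this
    rw [h3] at h2
    rw [h1, h2, Matrix.trace_mul_comm]
  have hdiag : ∀ p : ZMod N × W, (A ^ N) p p =
      ((List.range N).map fun i : ℕ => Lay (p.1 + i)).prod p.2 p.2 := by
    intro p
    rw [blockCyclic_pow_apply Lay A hA, if_pos (by rw [ZMod.natCast_self, add_zero])]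
  unfold Matrix.trace
  simp only [Matrix.diag_apply, hdiag]
  rw [Fintype.sum_prod_type]
  have : ∀ ℓ : ZMod N, ∑ w : W, ((List.range N).map fun i : ℕ => Lay (ℓ + i)).prod w w =
      (((List.range N).map fun i : ℕ => Lay (0 + i)).prod).trace := fun ℓ => hrot ℓ
  simp only [this, Finset.sum_const, Finset.card_univ, ZMod.card, nsmul_eq_mul]

end BlockCyclic

/-! ### Forms of degree `k` from matrices of linear forms -/

section Homogeneous

variable {K : Type*} [CommSemiring K] {σ : Type*}

/-- Entries of powers of a matrix of linear forms are forms of the corresponding degree.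
[folklore] -/
theorem isHomogeneous_pow_apply {ι : Type*} [Fintype ι] [DecidableEq ι]
    (A : Matrix ι ι (MvPolynomial σ K)) (hA : ∀ p q, (A p q).IsHomogeneous 1) (k : ℕ)
    (p q : ι) : ((A ^ k) p q).IsHomogeneous k := by
  induction k generalizing p q with
  | zero =>
    rw [pow_zero, Matrix.one_apply]
    split_ifs
    · exact isHomogeneous_one σ K
    · exact isHomogeneous_zero σ K 0
  | succ k ih =>
    rw [pow_succ, Matrix.mul_apply]
    exact IsHomogeneous.sum _ _ _ fun r _ => (ih p r).mul (hA r q)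

/-- The trace of the `k`-th power of a matrix of linear forms is a form of degree `k`.
[folklore] -/
theorem isHomogeneous_trace_pow {ι : Type*} [Fintype ι] [DecidableEq ι]
    (A : Matrix ι ι (MvPolynomial σ K)) (hA : ∀ p q, (A p q).IsHomogeneous 1) (k : ℕ) :
    ((A ^ k).trace).IsHomogeneous k :=
  IsHomogeneous.sum _ _ _ fun p _ => isHomogeneous_pow_apply A hA k p p

/-- An `if`-guarded form. [folklore] -/
theorem isHomogeneous_ite {P : Prop} [Decidable P] {φ : MvPolynomial σ K} {n : ℕ}
    (h : φ.IsHomogeneous n) : (if P then φ else 0).IsHomogeneous n := by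
  split_ifs
  · exact h
  · exact isHomogeneous_zero σ K n

end Homogeneous

/-! ### One layer of the Faddeev–LeVerrier program -/

section FL

variable {K : Type*} [Field K] [CharZero K] {σ : Type*} {m : ℕ}

/-- **One Faddeev–LeVerrier layer.** Let `M` be an `(m+1) × (m+1)` matrix and let the layer
matrix `E` on `W = Fin (m+1) × Fin (m+1)` be
`E (a', b') (a, b) = [b' = b] M a a' - [a = b] (k+1)⁻¹ M b' a'`. Then the row vector of the
entries of `N_{m-k}` times `E` is the row vector of the entries of `N_{m-k-1}`
(`N_l = flMat M l`): this is `N_{l-1} = M N_l + c_l 1` together with LeVerrier's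
`(m+1-l) c_l = -tr(M N_l)` at `l = m - k`. [cite: Altac2024, §11.8 eq. (11.104)–(11.106)] -/
theorem flVec_vecMul_flStep (M : Matrix (Fin (m + 1)) (Fin (m + 1)) (MvPolynomial σ K))
    {k : ℕ} (hk : k + 1 ≤ m)
    (E : Matrix (Fin (m + 1) × Fin (m + 1)) (Fin (m + 1) × Fin (m + 1)) (MvPolynomial σ K))
    (hE : ∀ v w, E v w = (if v.2 = w.2 then M w.1 v.1 else 0) -
      (if w.1 = w.2 then C ((k + 1 : K)⁻¹) * M v.2 v.1 else 0)) :
    Matrix.vecMul (fun v => flMat M (m - k) v.1 v.2) E =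
      fun w => flMat M (m - (k + 1)) w.1 w.2 := by
  -- LeVerrier: `(k+1) c_{m-k} = -tr(M N_{m-k})`
  have hlev := sub_mul_charpoly_coeff M (l := m - k) (by rw [Fintype.card_fin]; omega)
  rw [Fintype.card_fin, show m + 1 - (m - k) = k + 1 by omega] at hlev
  have hcoeff : M.charpoly.coeff (m - k) = -(C ((k + 1 : K)⁻¹) * (M * flMat M (m - k)).trace) := by
    have hk1 : ((k + 1 : ℕ) : MvPolynomial σ K) = C ((k : K) + 1) := by
      rw [← map_natCast C]; push_cast; rfl
    have hinv : C ((k + 1 : K)⁻¹) * ((k + 1 : ℕ) : MvPolynomial σ K) = 1 := by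
      rw [hk1, ← map_mul, inv_mul_cancel₀ (Nat.cast_add_one_ne_zero k), map_one]
    calc M.charpoly.coeff (m - k)
        = C ((k + 1 : K)⁻¹) * (((k + 1 : ℕ) : MvPolynomial σ K) * M.charpoly.coeff (m - k)) := by
          rw [← mul_assoc, hinv, one_mul]
      _ = -(C ((k + 1 : K)⁻¹) * (M * flMat M (m - k)).trace) := by rw [hlev, mul_neg]
  -- the recursion `N_{m-k-1} = M N_{m-k} + c_{m-k} 1`
  have hrec := flMat_eq_mul_add M (m - (k + 1))
  rw [show m - (k + 1) + 1 = m - k by omega] at hrec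
  funext w
  obtain ⟨a, b⟩ := w
  simp only [Matrix.vecMul, dotProduct, hE, mul_sub, Finset.sum_sub_distrib]
  rw [Fintype.sum_prod_type, Fintype.sum_prod_type]
  -- first sum: `(M N_{m-k}) a b`
  have h1 : ∑ a' : Fin (m + 1), ∑ b' : Fin (m + 1),
      flMat M (m - k) a' b' * (if b' = b then M a a' else 0) = (M * flMat M (m - k)) a b := by
    rw [Matrix.mul_apply]
    refine Finset.sum_congr rfl fun a' _ => ?_
    simp_rw [mul_ite, mul_zero]
    rw [Finset.sum_ite_eq' Finset.univ b, if_pos (Finset.mem_univ _), mul_comm]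
  -- second sum: `[a = b] (k+1)⁻¹ tr(M N_{m-k})`
  have h2 : ∑ a' : Fin (m + 1), ∑ b' : Fin (m + 1),
      flMat M (m - k) a' b' * (if a = b then C ((k + 1 : K)⁻¹) * M b' a' else 0) =
        if a = b then C ((k + 1 : K)⁻¹) * (M * flMat M (m - k)).trace else 0 := by
    split_ifs with hab
    · rw [← Matrix.trace_mul_comm, Matrix.trace]
      simp only [Matrix.diag_apply, Matrix.mul_apply, Finset.mul_sum]
      refine Finset.sum_congr rfl fun a' _ => Finset.sum_congr rfl fun b' _ => ?_
      ring
    · simp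
  rw [h1, h2, hrec, Matrix.add_apply, Matrix.smul_apply, Matrix.one_apply, smul_eq_mul, hcoeff]
  split_ifs <;> ring

/-! ### The program and its cyclic closure -/

/-- **The Faddeev–LeVerrier program, closed up cyclically** (Ikenmeyer–Landsberg 2017, Thm. 4.1
with Rem. 4.5, over a field of characteristic zero, with the Faddeev–LeVerrier recursion as the
branching program for the coefficients of the characteristic polynomial). Let `M` be an
`(m+1) × (m+1)` matrix of homogeneous linear forms and `n ≤ m`. For every scalar `θ` there is a
matrix `A` on `ZMod (n+1) × (Fin (m+1) × Fin (m+1))` (size `(n+1)(m+1)²`) whose entries are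
homogeneous linear forms and with `tr(A^{n+1}) = -(n+1)² θ · c_{m-n}(M)`, `c_j` the coefficients
of the characteristic polynomial of `M`. The layers: layer `0` is the source (one vertex `⋆`,
the other vertices of the block are isolated), layer `ℓ` (`1 ≤ ℓ ≤ n`) holds the entries of
`N_{m-ℓ}` (`N_m = 1`), the edges `ℓ → ℓ+1` are the Faddeev–LeVerrier layer
(`flVec_vecMul_flStep`), and the edges from layer `n` back to `⋆` carry `θ · M b a`, so that the
closed walks through `⋆` sum to `θ tr(M N_{m-n}) = -(n+1) θ c_{m-n}`; the factor `n+1` is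
`trace_blockCyclic_pow`. [cite: IkenmeyerLandsberg2017, Thm. 4.1 and Rem. 4.5] -/
theorem exists_trace_pow_eq_charpoly_coeff {n : ℕ} (hnm : n ≤ m)
    (M : Matrix (Fin (m + 1)) (Fin (m + 1)) (MvPolynomial σ K))
    (hM : ∀ i j, (M i j).IsHomogeneous 1) (θ : K) :
    ∃ A : Matrix (ZMod (n + 1) × (Fin (m + 1) × Fin (m + 1)))
        (ZMod (n + 1) × (Fin (m + 1) × Fin (m + 1))) (MvPolynomial σ K),
      (∀ p q, (A p q).IsHomogeneous 1) ∧
        (A ^ (n + 1)).trace =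
          -((((n + 1 : ℕ) : MvPolynomial σ K)) ^ 2 * C θ) * M.charpoly.coeff (m - n) := by
  classical
  -- the layer matrices, introduced through their defining equations only
  obtain ⟨star, -⟩ : ∃ _w : Fin (m + 1) × Fin (m + 1), True := ⟨(0, 0), trivial⟩
  obtain ⟨E, hEdef⟩ : ∃ E : ℕ → Matrix (Fin (m + 1) × Fin (m + 1)) (Fin (m + 1) × Fin (m + 1))
      (MvPolynomial σ K), ∀ k v w, E k v w = (if v.2 = w.2 then M w.1 v.1 else 0) -
        (if w.1 = w.2 then C ((k + 1 : K)⁻¹) * M v.2 v.1 else 0) :=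
    ⟨fun k => Matrix.of fun v w => (if v.2 = w.2 then M w.1 v.1 else 0) -
        (if w.1 = w.2 then C ((k + 1 : K)⁻¹) * M v.2 v.1 else 0), fun _ _ _ => rfl⟩
  obtain ⟨Xs, hXsdef⟩ : ∃ Xs : Matrix (Fin (m + 1) × Fin (m + 1)) (Fin (m + 1) × Fin (m + 1))
      (MvPolynomial σ K), ∀ v w, Xs v w = if w = star then C θ * M v.2 v.1 else 0 :=
    ⟨Matrix.of fun v w => if w = star then C θ * M v.2 v.1 else 0, fun _ _ => rfl⟩
  obtain ⟨T, hTdef⟩ : ∃ T : ℕ → Matrix (Fin (m + 1) × Fin (m + 1)) (Fin (m + 1) × Fin (m + 1))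
      (MvPolynomial σ K), ∀ k, T k = if k + 1 < n + 1 then E k else Xs :=
    ⟨fun k => if k + 1 < n + 1 then E k else Xs, fun _ => rfl⟩
  obtain ⟨F0, hF0def⟩ : ∃ F0 : Fin (m + 1) × Fin (m + 1) → MvPolynomial σ K,
      ∀ v, F0 v = if v.1 = v.2 then 1 else 0 := ⟨fun v => if v.1 = v.2 then 1 else 0, fun _ => rfl⟩
  obtain ⟨M0, hM0def⟩ : ∃ M0 : Matrix (Fin (m + 1) × Fin (m + 1)) (Fin (m + 1) × Fin (m + 1))
      (MvPolynomial σ K), ∀ v w, M0 v w = if v = star then Matrix.vecMul F0 (T 0) w else 0 :=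
    ⟨Matrix.of fun v w => if v = star then Matrix.vecMul F0 (T 0) w else 0, fun _ _ => rfl⟩
  obtain ⟨Lay, hLaydef⟩ : ∃ Lay : ZMod (n + 1) → Matrix (Fin (m + 1) × Fin (m + 1))
      (Fin (m + 1) × Fin (m + 1)) (MvPolynomial σ K), ∀ ℓ, Lay ℓ = if ℓ = 0 then M0 else T ℓ.val :=
    ⟨fun ℓ => if ℓ = 0 then M0 else T ℓ.val, fun _ => rfl⟩
  obtain ⟨A, hA⟩ : ∃ A : Matrix (ZMod (n + 1) × (Fin (m + 1) × Fin (m + 1)))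
      (ZMod (n + 1) × (Fin (m + 1) × Fin (m + 1))) (MvPolynomial σ K),
      ∀ p q, A p q = if q.1 = p.1 + 1 then Lay p.1 p.2 q.2 else 0 :=
    ⟨Matrix.of fun p q => if q.1 = p.1 + 1 then Lay p.1 p.2 q.2 else 0, fun _ _ => rfl⟩
  -- homogeneity of the entries
  have hE : ∀ k v w, (E k v w).IsHomogeneous 1 := by
    intro k v w
    rw [hEdef]
    exact (isHomogeneous_ite (hM _ _)).sub (isHomogeneous_ite ((hM _ _).C_mul _))
  have hXs : ∀ v w, (Xs v w).IsHomogeneous 1 := by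
    intro v w
    rw [hXsdef]
    exact isHomogeneous_ite ((hM _ _).C_mul _)
  have hT : ∀ k v w, (T k v w).IsHomogeneous 1 := by
    intro k v w
    rw [hTdef]
    split_ifs
    · exact hE k v w
    · exact hXs v w
  have hM0 : ∀ v w, (M0 v w).IsHomogeneous 1 := by
    intro v w
    rw [hM0def]
    refine isHomogeneous_ite (IsHomogeneous.sum _ _ _ fun u _ => ?_)
    have h0 : (F0 u).IsHomogeneous 0 := by
      rw [hF0def]
      split_ifs
      · exact isHomogeneous_one σ K
      · exact isHomogeneous_zero σ K 0
    simpa using h0.mul (hT 0 u w)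
  have hLay : ∀ ℓ v w, (Lay ℓ v w).IsHomogeneous 1 := by
    intro ℓ v w
    rw [hLaydef]
    split_ifs
    · exact hM0 v w
    · exact hT _ v w
  refine ⟨A, fun p q => ?_, ?_⟩
  · rw [hA]
    exact isHomogeneous_ite (hLay _ _ _)
  -- the trace: reduce to the cyclic product starting at layer `0`
  rw [trace_blockCyclic_pow Lay A hA]
  -- the cyclic product from layer `0` is `M0 · T 1 ⋯ T n`
  have hprod : ∀ k, k ≤ n → ((List.range (k + 1)).map fun i : ℕ => Lay (0 + i)).prod =
      M0 * ((List.range k).map fun i : ℕ => T (i + 1)).prod := by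
    intro k hk
    induction k with
    | zero =>
      rw [layerProd_succ, List.range_zero, List.map_nil, List.prod_nil, List.map_nil,
        List.prod_nil, Matrix.one_mul, Matrix.mul_one, Nat.cast_zero, add_zero, hLaydef,
        if_pos rfl]
    | succ k ih =>
      have hval : ((0 : ZMod (n + 1)) + ((k + 1 : ℕ) : ZMod (n + 1))).val = k + 1 := by
        rw [zero_add, ZMod.val_natCast, Nat.mod_eq_of_lt (by omega)]
      have hne : (0 : ZMod (n + 1)) + ((k + 1 : ℕ) : ZMod (n + 1)) ≠ 0 := by
        intro h
        rw [h, ZMod.val_zero] at hval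
        omega
      have hL : Lay ((0 : ZMod (n + 1)) + ((k + 1 : ℕ) : ZMod (n + 1))) = T (k + 1) := by
        rw [hLaydef, if_neg hne, hval]
      rw [layerProd_succ, ih (Nat.le_of_succ_le hk), List.range_succ, List.map_append,
        List.map_singleton, List.prod_append, List.prod_singleton, Matrix.mul_assoc, hL]
  -- prefix products of the layers `T 0, T 1, …` and the Faddeev–LeVerrier invariant
  have hTprod : ∀ k, ((List.range (k + 1)).map T).prod =
      T 0 * ((List.range k).map fun i : ℕ => T (i + 1)).prod := by
    intro k
    induction k with
    | zero =>
      rw [List.range_succ, List.range_zero, List.nil_append, List.map_singleton,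
        List.prod_singleton, List.map_nil, List.prod_nil, Matrix.mul_one]
    | succ k ih =>
      rw [List.range_succ, List.map_append, List.map_singleton, List.prod_append,
        List.prod_singleton, ih, List.range_succ, List.map_append, List.map_singleton,
        List.prod_append, List.prod_singleton, Matrix.mul_assoc]
  have hF0 : F0 = fun v => flMat M (m - 0) v.1 v.2 := by
    funext v
    have h := flMat_card_sub_one M
    rw [Fintype.card_fin, Nat.add_sub_cancel] at h
    rw [Nat.sub_zero, h, Matrix.one_apply, hF0def]
  have hinv : ∀ k, k ≤ n → Matrix.vecMul F0 (((List.range k).map T).prod) =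
      fun v => flMat M (m - k) v.1 v.2 := by
    intro k hk
    induction k with
    | zero => rw [List.range_zero, List.map_nil, List.prod_nil, Matrix.vecMul_one, hF0]
    | succ k ih =>
      rw [List.range_succ, List.map_append, List.map_singleton, List.prod_append,
        List.prod_singleton, ← Matrix.vecMul_vecMul, ih (Nat.le_of_succ_le hk)]
      have hTk : T k = E k := by rw [hTdef, if_pos (by omega)]
      rw [hTk]
      exact flVec_vecMul_flStep M (by omega) (E k) (hEdef k)
  -- LeVerrier at `l = m - n`: `(n+1) c_{m-n} = -tr(M N_{m-n})`
  have hlev := sub_mul_charpoly_coeff M (l := m - n) (by rw [Fintype.card_fin]; omega)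
  rw [Fintype.card_fin, show m + 1 - (m - n) = n + 1 by omega] at hlev
  -- assemble
  rw [hprod n le_rfl]
  have htr : (M0 * ((List.range n).map fun i : ℕ => T (i + 1)).prod).trace =
      Matrix.vecMul (Matrix.vecMul F0 (T 0)) (((List.range n).map fun i : ℕ => T (i + 1)).prod)
        star := by
    rw [Matrix.trace]
    simp only [Matrix.diag_apply, Matrix.mul_apply]
    rw [Fintype.sum_eq_single star (fun v hv => by simp [hM0def, hv])]
    simp only [hM0def, if_true, Matrix.vecMul, dotProduct]
  rw [htr, Matrix.vecMul_vecMul, ← hTprod n]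
  rw [List.range_succ, List.map_append, List.map_singleton, List.prod_append, List.prod_singleton,
    ← Matrix.vecMul_vecMul, hinv n le_rfl]
  have hTn : T n = Xs := by rw [hTdef, if_neg (lt_irrefl _)]
  rw [hTn]
  simp only [Matrix.vecMul, dotProduct, hXsdef, if_true]
  -- `∑_{(a,b)} N_{m-n} a b · θ M b a = θ tr(M N_{m-n}) = -(n+1) θ c_{m-n}`
  have hsum : ∑ v : Fin (m + 1) × Fin (m + 1), flMat M (m - n) v.1 v.2 * (C θ * M v.2 v.1) =
      C θ * (M * flMat M (m - n)).trace := by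
    rw [← Matrix.trace_mul_comm, Matrix.trace, Fintype.sum_prod_type, Finset.mul_sum]
    refine Finset.sum_congr rfl fun a _ => ?_
    rw [Matrix.diag_apply, Matrix.mul_apply, Finset.mul_sum]
    refine Finset.sum_congr rfl fun b _ => ?_
    ring
  rw [hsum]
  have htr' : (M * flMat M (m - n)).trace =
      -(((n + 1 : ℕ) : MvPolynomial σ K) * M.charpoly.coeff (m - n)) := by
    rw [hlev, neg_neg]
  rw [htr']
  ring

/-! ### Consequences: homogeneity of the coefficients, the top form of `det(1 - M)` -/

/-- The coefficient `c_{m-n}` of the characteristic polynomial of an `(m+1) × (m+1)` matrix of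
homogeneous linear forms is a form of degree `n + 1` (`n ≤ m`; it is the trace of the
`(n+1)`-th power of the matrix of `exists_trace_pow_eq_charpoly_coeff` with `θ = -1/(n+1)²`).
[folklore] -/
theorem charpoly_coeff_isHomogeneous (M : Matrix (Fin (m + 1)) (Fin (m + 1)) (MvPolynomial σ K))
    (hM : ∀ i j, (M i j).IsHomogeneous 1) {n : ℕ} (hnm : n ≤ m) :
    (M.charpoly.coeff (m - n)).IsHomogeneous (n + 1) := by
  obtain ⟨A, hA, htr⟩ :=
    exists_trace_pow_eq_charpoly_coeff hnm M hM (-((n + 1 : K) ^ 2)⁻¹)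
  have hn : ((n + 1 : ℕ) : MvPolynomial σ K) = C ((n : K) + 1) := by
    rw [← map_natCast C]; push_cast; rfl
  have hc : -((((n + 1 : ℕ) : MvPolynomial σ K)) ^ 2 * C (-((n + 1 : K) ^ 2)⁻¹)) = 1 := by
    rw [hn, ← map_pow, ← map_mul, ← map_neg, ← map_one C, mul_neg, neg_neg,
      mul_inv_cancel₀ (pow_ne_zero 2 (Nat.cast_add_one_ne_zero n))]
  rw [hc, one_mul] at htr
  rw [← htr]
  exact isHomogeneous_trace_pow A hA (n + 1)

/-- **The top form of `det(1 - M)`.** For an `(m+1) × (m+1)` matrix `M` of homogeneous linear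
forms and `1 ≤ d = n+1 ≤ m+1`, the homogeneous component of degree `d` of `det(1 - M)` is the
coefficient `c_{m-n}` of the characteristic polynomial of `M` (`det(1 - M) = χ_M(1) = ∑ⱼ cⱼ` and
`cⱼ` is a form of degree `m+1-j`). [folklore] -/
theorem homogeneousComponent_det_one_sub
    (M : Matrix (Fin (m + 1)) (Fin (m + 1)) (MvPolynomial σ K))
    (hM : ∀ i j, (M i j).IsHomogeneous 1) {n : ℕ} (hnm : n ≤ m) :
    homogeneousComponent (n + 1) (1 - M).det = M.charpoly.coeff (m - n) := by
  -- `det(1 - M) = χ_M(1) = ∑ⱼ cⱼ`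
  have heval : (1 - M).det = ∑ j ∈ Finset.range (m + 2), M.charpoly.coeff j := by
    have hscalar : Matrix.scalar (Fin (m + 1)) (1 : MvPolynomial σ K) = 1 := by
      ext i j
      simp [Matrix.scalar_apply, Matrix.one_apply]
    rw [← hscalar, ← Matrix.eval_charpoly, Polynomial.eval_eq_sum_range,
      Matrix.charpoly_natDegree_eq_dim, Fintype.card_fin]
    simp
  rw [heval, map_sum]
  rw [Finset.sum_eq_single (m - n)]
  · exact homogeneousComponent_eq_self (charpoly_coeff_isHomogeneous M hM hnm)
  · intro j hj hne
    have hjm : j ≤ m + 1 := by have := Finset.mem_range.1 hj; omega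
    -- `c_j` is homogeneous of degree `m + 1 - j ≠ n + 1`
    have hhom : (M.charpoly.coeff j).IsHomogeneous (m + 1 - j) := by
      rcases Nat.lt_or_ge j (m + 1) with hlt | hge
      · have h := charpoly_coeff_isHomogeneous M hM (n := m - j) (by omega)
        rwa [show m - (m - j) = j by omega, show m - j + 1 = m + 1 - j by omega] at h
      · have hj' : j = m + 1 := le_antisymm hjm hge
        subst hj'
        have hmonic := M.charpoly_monic
        rw [Polynomial.Monic, Polynomial.leadingCoeff, Matrix.charpoly_natDegree_eq_dim,
          Fintype.card_fin] at hmonic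
        rw [hmonic, Nat.sub_self]
        exact isHomogeneous_one σ K
    rw [homogeneousComponent_of_mem ((mem_homogeneousSubmodule _ _).mpr hhom), if_neg (by omega)]
  · intro h
    exact absurd (Finset.mem_range.2 (by omega)) h

end FL

end FLPowTrace

end Literature.Computability.AlgebraicComplexity

/-!
## Appendix: from determinantal expressions to traces of matrix powers — the discharge
(Ikenmeyer–Landsberg 2017, Thm. 4.1 with Rem. 4.5)

This appendix (same proposal series; kept in this file rather than a sibling
`PowTraceFromDetReprProofs.lean` so that it elaborates against built imports only) discharges the
named fact `Literature.Computability.AlgebraicComplexity.IkenmeyerLandsberg2017_powTrace_of_detRepr`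
of `PowTraceFromDetRepr.lean`:
over `ℂ`, a homogeneous `P` of degree `d ≥ 1` with an affine determinantal expression of size `s`
is `tr(A^d)` for a matrix `A` of homogeneous linear forms of size `N` with
`N + 1 ≤ (d+1) φ(s)`, `φ(s) = (s³ - s)/3 + 2`.

## Proof (the printed chain, with one substitution)

Ikenmeyer–Landsberg prove `hmpc(P) ≤ himmc(P) = dlabpc(P) - 1 ≤ (d+1) abpc(P) - 1
≤ (d+1) labpc(P) - 1 ≤ (d+1) φ(dc P) - 1` (Thm. 4.1, Rem. 4.5): an affine determinantal
expression of size `s` is turned into a layered algebraic branching program (ABP) for `P` by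
substituting into the Mahajan–Vinay clow-sequence ABP for `det_s` (size `φ(s)`), the ABP is
homogenised (`× (d+1)`), and a degree-layered ABP with `d` layers is read as `tr(A^d)` after
identifying source and sink. We follow this chain with ONE substitution, legitimate over `ℂ`
(characteristic zero) and cheaper than the printed bound: the branching program for the
determinant is the **Faddeev–LeVerrier program** above (width `s²`,
already degree-layered, correctness = LeVerrier's trace identities proved in
`Literature/LinearAlgebra/Matrix/FaddeevLeVerrier.lean`) instead of Mahajan–Vinay's (whose
correctness is the clow involution, not in the tree). In detail:

1. `P = 0`: the empty matrix. Otherwise `d = deg P ≤ s` (`totalDegree_le_of_hasDetRepr_holds`).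
2. **Invertible constant part by translation.** Pick `x₀` with `P(x₀) ≠ 0` (`ℂ` is infinite,
   `MvPolynomial.funext`) and translate `x ↦ x + x₀`: the affine matrix `B` with `det B = P`
   becomes `C' + L₀ = C'(1 + L)` with `C' = B(x₀)` invertible (`det C' = P(x₀)`) and `L`
   a matrix of linear forms, while `P` is the top homogeneous component of `P(x + x₀)`
   (`weightedHomogeneousComponent_translate`, EGOW 2018 file). Hence
   `P = det C' · [det(1 + L)]_d = det C' · c_{s-d}(-L)`
   (`FLPowTrace.homogeneousComponent_det_one_sub`).
3. **The program.** `FLPowTrace.exists_trace_pow_eq_charpoly_coeff` with `θ = -det C'/d²`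
   gives `A` on `ZMod d × (Fin s × Fin s)` with linear entries and `tr(A^d) = P`; transport
   to `Fin (d s²)` (`Matrix.reindexAlgEquiv`, `trace_reindex` of `SymmetrizedMatMul.lean`).
4. **Size.** `d s² + 1 ≤ (d+1)((s³-s)/3 + 2)` for all `d, s ≥ 1` (`sq_le_phi`), well inside
   the printed `(d+1) φ(s)`.

Rem. 4.5 reads `tr(A^m)` as the sum over closed walks of length `m` and says these "are in
bijection to paths from the source to the sink"; a closed walk is counted once per starting
vertex, i.e. `d` times per source–sink path, and the resulting factor `d` is removed by the
rescaling `θ` (characteristic zero) — as in the tree's Grenet file for `pc(per_m) ≤ 2^m - 1`.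

## References

* C. Ikenmeyer, J. M. Landsberg, *On the complexity of the permanent in various computational
  models*, J. Pure Appl. Algebra 221 (2017) 2911–2927 = arXiv:1610.00159 (held; `lit read`,
  p. 7: Thm. 4.1, Rem. 4.5; p. 4: Def. 2.1–2.2). [IkenmeyerLandsberg2017]
* Z. Altaç, *Numerical Methods for Scientists and Engineers*, CRC 2024, §11.8
  (Faddeev–LeVerrier). [Altac2024]
-/

namespace Literature.Computability.AlgebraicComplexity

open MvPolynomial

namespace PowTraceFromDetRepr

/-! ### Affine polynomials under translation -/

section Affine

variable {K : Type*} [Field K] {σ : Type*}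

/-- A polynomial of total degree `≤ 1` is its constant term plus its linear form. [folklore] -/
theorem eq_C_add_homogeneousComponent_one (p : MvPolynomial σ K) (hp : p.totalDegree ≤ 1) :
    p = C (coeff 0 p) + homogeneousComponent 1 p := by
  have h := sum_homogeneousComponent p
  rcases Nat.lt_or_ge p.totalDegree 1 with h0 | h1
  · have h0' : p.totalDegree = 0 := by omega
    rw [h0', Finset.sum_range_one, homogeneousComponent_zero] at h
    rw [homogeneousComponent_eq_zero 1 p (by omega), add_zero]
    exact h.symm
  · have h1' : p.totalDegree = 1 := le_antisymm hp h1
    rw [h1', Finset.sum_range_succ, Finset.sum_range_one, homogeneousComponent_zero] at h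
    exact h.symm

/-- **Translating an affine linear form**: for `p` of total degree `≤ 1`,
`p(x + a) = p(a) + (the linear part of p(x + a))`, and that linear part is a homogeneous linear
form (it is in fact the linear part of `p`). [folklore] -/
theorem translate_affine [DecidableEq σ] (a : σ → K) (p : MvPolynomial σ K)
    (hp : p.totalDegree ≤ 1) :
    eval₂Hom C (fun v => X v + C (a v)) p =
      C (eval a p) + homogeneousComponent 1 (eval₂Hom C (fun v => X v + C (a v)) p) := by
  set τ : MvPolynomial σ K →+* MvPolynomial σ K := eval₂Hom C (fun v => X v + C (a v)) with hτ
  -- `deg p(x + a) ≤ 1`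
  have hdeg : (τ p).totalDegree ≤ 1 := by
    have h1 : ∀ v, (X v + C (a v) : MvPolynomial σ K).totalDegree ≤ 1 := fun v =>
      (totalDegree_add _ _).trans (max_le (totalDegree_X (R := K) v).le (by simp))
    have h := HasDetRepr.totalDegree_aeval_le_of_le_one (fun v => X v + C (a v)) h1 p
    rw [aeval_eq_eval₂Hom, algebraMap_eq] at h
    exact h.trans hp
  -- the constant term of `p(x + a)` is `p(a)`
  have hconst : coeff 0 (τ p) = eval a p := by
    have hcomp : constantCoeff.comp τ = eval a := by
      refine ringHom_ext (fun r => ?_) (fun i => ?_)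
      · simp [hτ]
      · simp [hτ]
    have h := RingHom.congr_fun hcomp p
    rw [RingHom.comp_apply, constantCoeff_eq] at h
    exact h
  conv_lhs => rw [eq_C_add_homogeneousComponent_one (τ p) hdeg]
  rw [hconst]

end Affine

/-! ### The size bound -/

/-- `s² ≤ (s³ - s)/3 + 2` for every natural number `s` (so that `d s² + 1 ≤ (d+1) φ(s)`).
[folklore] -/
theorem sq_le_phi (s : ℕ) : s * s ≤ (s ^ 3 - s) / 3 + 2 := by
  rcases Nat.lt_or_ge s 3 with hs | hs
  · interval_cases s <;> decide
  · have hkey : (s * s - 2) * 3 ≤ s ^ 3 - s := by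
      apply Nat.le_sub_of_add_le
      have h6 : 2 ≤ s * s := by nlinarith
      zify [h6]
      nlinarith [mul_nonneg (sub_nonneg.mpr (show (3 : ℤ) ≤ s by exact_mod_cast hs))
        (sub_nonneg.mpr (show (1 : ℤ) ≤ (s : ℤ) * s by nlinarith))]
    have h := (Nat.le_div_iff_mul_le (by norm_num : 0 < 3)).mpr hkey
    omega

/-! ### The discharge -/

/-- **Ikenmeyer–Landsberg 2017, Thm. 4.1 with Rem. 4.5** — discharge of the named fact
`IkenmeyerLandsberg2017_powTrace_of_detRepr`: over `ℂ`, a homogeneous polynomial `P` of degree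
`d ≥ 1` with an affine determinantal expression of size `s` is `tr(A^d)` for an `N × N` matrix
`A` of homogeneous linear forms with `N + 1 ≤ (d+1)((s³ - s)/3 + 2)`. Proof: translate to make
the constant part of the expression invertible, factor it out, and run the Faddeev–LeVerrier
branching program for the coefficient `c_{s-d}` of the characteristic polynomial of the linear
part, closed up cyclically (`FLPowTrace.exists_trace_pow_eq_charpoly_coeff`); here `N = d s²`.
[cite: IkenmeyerLandsberg2017, Thm. 4.1 and Rem. 4.5] -/
theorem _root_.Literature.Computability.AlgebraicComplexity.IkenmeyerLandsberg2017_powTrace_of_detRepr_holds :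
    IkenmeyerLandsberg2017_powTrace_of_detRepr := by
  intro M _ P d s hd hP hdet
  classical
  -- `P = 0`: the empty matrix
  by_cases hP0 : P = 0
  · subst hP0
    refine ⟨0, 0, ?_, fun i => Fin.elim0 i, ?_⟩
    · calc 0 + 1 = 1 * 1 := rfl
        _ ≤ (d + 1) * ((s ^ 3 - s) / 3 + 2) := Nat.mul_le_mul (by omega) (by omega)
    · rw [zero_pow (by omega), Matrix.trace_zero]
  -- `1 ≤ d ≤ s`: write `d = n + 1`, `s = m + 1`, `n ≤ m`
  have hds : d ≤ s := by
    have h1 := hP.totalDegree hP0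
    have h2 : P.totalDegree ≤ s := totalDegree_le_of_hasDetRepr_holds hdet
    omega
  obtain ⟨n, rfl⟩ : ∃ n, d = n + 1 := ⟨d - 1, by omega⟩
  obtain ⟨m, rfl⟩ : ∃ m, s = m + 1 := ⟨s - 1, by omega⟩
  have hnm : n ≤ m := by omega
  obtain ⟨B, hB1, hBdet⟩ := hdet
  -- a point where `P` does not vanish (`ℂ` is infinite)
  obtain ⟨x₀, hx₀⟩ : ∃ x₀ : M → ℂ, eval x₀ P ≠ 0 := by
    by_contra h
    push Not at h
    exact hP0 (MvPolynomial.funext fun x => by rw [h x, map_zero])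
  -- translation `x ↦ x + x₀`; `P` is the top form of `P(x + x₀)`
  set τ : MvPolynomial M ℂ →+* MvPolynomial M ℂ := eval₂Hom C (fun v => X v + C (x₀ v)) with hτ
  have hτP : homogeneousComponent (n + 1) (τ P) = P :=
    weightedHomogeneousComponent_translate (1 : M → ℕ) (AddMonoidHom.id ℕ) (fun _ => rfl) x₀ hP
  -- constant part `C' = B(x₀)` (invertible) and linear part `L₀` of the translated matrix
  set C' : Matrix (Fin (m + 1)) (Fin (m + 1)) ℂ := B.map (eval x₀) with hC'
  set L₀ : Matrix (Fin (m + 1)) (Fin (m + 1)) (MvPolynomial M ℂ) :=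
    Matrix.of fun i j => homogeneousComponent 1 (τ (B i j)) with hL₀
  have hτB : τ.mapMatrix B = C'.map C + L₀ := by
    refine Matrix.ext fun i j => ?_
    simp only [RingHom.mapMatrix_apply, Matrix.map_apply, Matrix.add_apply, hC', hL₀,
      Matrix.of_apply]
    exact translate_affine x₀ (B i j) (hB1 i j)
  have hC'det : C'.det = eval x₀ P := by
    rw [← hBdet, RingHom.map_det, RingHom.mapMatrix_apply]
  have hunit : IsUnit C'.det := isUnit_iff_ne_zero.mpr (hC'det ▸ hx₀)
  set L : Matrix (Fin (m + 1)) (Fin (m + 1)) (MvPolynomial M ℂ) := (C'⁻¹).map C * L₀ with hL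
  have hCL : C'.map C * L = L₀ := by
    rw [hL, ← Matrix.mul_assoc, ← Matrix.map_mul, Matrix.mul_nonsing_inv _ hunit,
      Matrix.map_one _ (map_zero C) (map_one C), Matrix.one_mul]
  have hfactor : τ.mapMatrix B = C'.map C * (1 + L) := by
    rw [Matrix.mul_add, Matrix.mul_one, hCL, hτB]
  have hτPdet : τ P = C C'.det * (1 + L).det := by
    rw [← hBdet, RingHom.map_det, hfactor, Matrix.det_mul, ← RingHom.mapMatrix_apply,
      ← RingHom.map_det]
  -- `L` is a matrix of linear forms
  have hLhom : ∀ i j, (L i j).IsHomogeneous 1 := by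
    intro i j
    simp only [hL, Matrix.mul_apply, Matrix.map_apply, hL₀, Matrix.of_apply]
    exact IsHomogeneous.sum _ _ _ fun k _ => (homogeneousComponent_isHomogeneous 1 _).C_mul _
  have hnegL : ∀ i j, ((-L) i j).IsHomogeneous 1 := fun i j => by
    rw [Matrix.neg_apply]
    exact (hLhom i j).neg
  -- `P = det C' · c_{m-n}(-L)`
  have hPeq : P = C C'.det * (-L).charpoly.coeff (m - n) := by
    rw [← hτP, hτPdet, homogeneousComponent_C_mul,
      ← FLPowTrace.homogeneousComponent_det_one_sub (-L) hnegL hnm, sub_neg_eq_add]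
  -- the Faddeev–LeVerrier program, closed up cyclically, rescaled by `θ = -det C'/(n+1)²`
  obtain ⟨A, hA, htr⟩ := FLPowTrace.exists_trace_pow_eq_charpoly_coeff hnm (-L) hnegL
    (-(C'.det / ((n : ℂ) + 1) ^ 2))
  have htrP : (A ^ (n + 1)).trace = P := by
    rw [htr, hPeq]
    congr 1
    have hn : ((n + 1 : ℕ) : MvPolynomial M ℂ) = C ((n : ℂ) + 1) := by
      rw [← map_natCast C]; push_cast; rfl
    rw [hn, ← map_pow, ← map_mul, ← map_neg]
    congr 1
    have hn0 : ((n : ℂ) + 1) ≠ 0 := Nat.cast_add_one_ne_zero n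
    field_simp
  -- transport to `Fin N`, `N = (n+1)(m+1)²`
  let e := Fintype.equivFin (ZMod (n + 1) × (Fin (m + 1) × Fin (m + 1)))
  refine ⟨Fintype.card (ZMod (n + 1) × (Fin (m + 1) × Fin (m + 1))), Matrix.reindex e e A,
    ?_, fun i j => ?_, ?_⟩
  · -- the size bound `(n+1)(m+1)² + 1 ≤ (n+2)((s³-s)/3 + 2)`
    rw [Fintype.card_prod, ZMod.card, Fintype.card_prod, Fintype.card_fin]
    have h := sq_le_phi (m + 1)
    calc (n + 1) * ((m + 1) * (m + 1)) + 1
        ≤ (n + 1) * (((m + 1) ^ 3 - (m + 1)) / 3 + 2) + (((m + 1) ^ 3 - (m + 1)) / 3 + 2) :=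
          add_le_add (Nat.mul_le_mul_left _ h) (by omega)
      _ = (n + 1 + 1) * (((m + 1) ^ 3 - (m + 1)) / 3 + 2) := by ring
  · rw [Matrix.reindex_apply, Matrix.submatrix_apply]
    exact hA _ _
  · -- powers and traces commute with reindexing (`Matrix.reindexAlgEquiv`, `trace_reindex`)
    have hpow : Matrix.reindex e e A ^ (n + 1) = Matrix.reindex e e (A ^ (n + 1)) := by
      rw [← Matrix.coe_reindexAlgEquiv (R := ℂ) (A := MvPolynomial M ℂ) e, map_pow]
    rw [hpow, trace_reindex, htrP]

end PowTraceFromDetRepr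

end Literature.Computability.AlgebraicComplexity
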